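import Summits.QuantumFields.YangMills.Theorems.UnitScaleTiltHistoryTailHaarForest

/-!
# THE EXACTNESS ENGINE for `Ū_*(dU) = dV`: private coordinates + left-equivariance ⇒ the law of the coarse field is EXACT product Haar

Support file for `Summit.QuantumFields.YangMills.Theses.UnitScaleTilt.HistoryTailL` (stmt-QuantumFields-19936; fleet unit ym-ust-18916-p1 g4; finding
F-g4-1 §2/§5, OWNER RULING g18-№3 §2 «(R1) … recorded as the standing alternative; if the v3 socket should stall, (R1b) is the fallback»).  Companion of
`…Theorems.HaarForest` (forests are exact for every covariant averaging) and `…Theorems.HaarFibreDefect` (the (0.4)/`ℰp` fibre law is not Haar).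

THE MECHANISM behind every exact case of E6′ (the axial averaging `stdAvg_map`; the abelian case; own-direction-last contour families — F-g4-1 §2, DEPMAP
§16.5 (b1)(b2)), abstractly, for a measurable map `V : (ι → G) → (κ → G)` from fine to coarse bond variables under product Haar `dU`:

* §1 **coordinatewise left-invariance ⇒ product Haar** (`eq_pi_haar_of_forall_map_update_mul`): a probability measure on `κ → G` invariant under
  `W ↦ W[k ↦ g·W k]` for every coordinate `k` and every `g` IS `⊗_κ haar` — induction on boxes with `HaarForest.prod_apply_eq_haar_mul_of_mapMulLeft`
  (no topology, no uniqueness theorem: only the bi-invariance of the probability `HaarData.haar`);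
* §2 **skew left translations preserve `dU`** (`measurePreserving_skewMulLeft`): `U ↦ (i ↦ a_i(U)·U_i on the moving coordinates, U_i on the fixed ones)`
  with factors `a_i(U)` reading only the FIXED coordinates preserves product Haar (Fubini: `MeasurePreserving.skew_product` through
  `MeasurableEquiv.piEquivPiSubtypeProd`, and left-invariance of `haar` coordinatewise);
* §3 **THE ENGINE** (`map_eq_pi_haar_of_private`): if for every coarse coordinate `k` and every `g ∈ G` some skew left translation of §2 (moving
  only `k`'s PRIVATE fine coordinates, with factors blind to them) realises `V ↦ V[k ↦ g·V k]` — i.e. left-translates the `k`-th coarse variable and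
  fixes all others — then `V_*(dU) = ⊗_κ haar` EXACTLY.

For a block averaging the hypothesis of §3 is met when every word through a private face-crossing bond `q_a` of `c` has ONE common prefix `A_a` (take
`a_{q_a} := A_a⁻¹ g A_a`, left-equivariance (0.6) of the inner average does the rest) — true for the axial transporter and for single-ordering
own-direction-last contours, false for the symmetric (0.4) family (`HaarFibreDefect`).  Elementary measure theory ([folklore]); nothing of Bałaban's is
asserted; no averaging is constructed here; not a claim about the mass gap.  No `sorry`, no definitions, standard axioms.
-/

noncomputable section

namespace Summit.QuantumFields.YangMills.Theorems.HaarExactEngine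

open _root_.MeasureTheory
open Literature.MathematicalPhysics.QuantumFieldTheory.Balaban1983to89
open Summit.QuantumFields.YangMills.Theorems.HaarForest (prod_apply_eq_haar_mul_of_mapMulLeft)

variable {G : Type*} [GaugeGroup G] [MeasurableSpace G] [HaarData G] [MeasurableMul₂ G]

/-! ## §1 Coordinatewise left-invariance ⇒ product Haar -/

section Coordinatewise

variable {κ : Type*} [Fintype κ] [DecidableEq κ]

omit [HaarData G] [Fintype κ] in
/-- The translation of one coordinate: `W ↦ W[k ↦ g · W k]`. [folklore] -/
theorem measurable_update_mul (k : κ) (g : G) :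
    Measurable fun W : κ → G => Function.update W k (g * W k) :=
  measurable_pi_lambda _ fun i => by
    by_cases hi : i = k
    · subst hi
      simp only [Function.update_self]
      have h : Measurable fun W : κ → G => W i := measurable_pi_apply i
      exact h.const_mul g
    · simp only [Function.update_of_ne hi]
      exact measurable_pi_apply i

omit [HaarData G] [MeasurableMul₂ G] [Fintype κ] in
/-- Forget coordinate `k` (set it to `1`) and remember it separately: `W ↦ (W k, W[k ↦ 1])`. [folklore] -/
theorem measurable_split (k : κ) :
    Measurable fun W : κ → G => (W k, Function.update W k (1 : G)) :=
  (measurable_pi_apply k).prodMk (measurable_pi_lambda _ fun i => by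
    by_cases hi : i = k
    · subst hi; simp only [Function.update_self]; exact measurable_const
    · simp only [Function.update_of_ne hi]; exact measurable_pi_apply i)

/-- BOX INDUCTION: for a coordinatewise left-invariant finite measure, the mass of the box constrained on a finite set `S` of coordinates is
`ν(univ) · ∏_{k ∈ S} haar (s k)`. [folklore] -/
theorem measure_box_eq (ν : Measure (κ → G)) [IsFiniteMeasure ν]
    (hν : ∀ (k : κ) (g : G), ν.map (fun W => Function.update W k (g * W k)) = ν)
    (s : κ → Set G) (hs : ∀ k, MeasurableSet (s k)) (S : Finset κ) :
    ν {W | ∀ k ∈ S, W k ∈ s k} = ν Set.univ * ∏ k ∈ S, HaarData.haar (s k) := by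
  classical
  induction S using Finset.induction_on with
  | empty => simp
  | @insert k S hk ih =>
    -- the split at coordinate `k`
    set ψ : (κ → G) → G × (κ → G) := fun W => (W k, Function.update W k (1 : G)) with hψ
    have hψm : Measurable ψ := measurable_split k
    set ν' : Measure (G × (κ → G)) := ν.map ψ with hν'
    haveI : IsFiniteMeasure ν' := by rw [hν']; infer_instance
    -- left-invariance of the split measure in the `G`-coordinate
    have hinv : ∀ g : G, ν'.map (fun p : G × (κ → G) => (g * p.1, p.2)) = ν' := by
      intro g
      rw [hν', Measure.map_map ((measurable_fst.const_mul g).prodMk measurable_snd) hψm]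
      have hcomp : (fun p : G × (κ → G) => (g * p.1, p.2)) ∘ ψ = ψ ∘ fun W => Function.update W k (g * W k) := by
        funext W
        simp only [Function.comp_apply, hψ, Function.update_self, Function.update_idem]
      rw [hcomp, ← Measure.map_map hψm (measurable_update_mul k g), hν k g]
    -- the rectangle identity for the box
    set t : Set (κ → G) := {W | ∀ k' ∈ S, W k' ∈ s k'} with ht
    have htm : MeasurableSet t := by
      have : t = ⋂ k' ∈ S, (fun W : κ → G => W k') ⁻¹' s k' := by
        ext W; simp [ht]
      rw [this]
      exact MeasurableSet.biInter (Set.to_countable _) fun k' _ => measurable_pi_apply k' (hs k')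
    have hrect := prod_apply_eq_haar_mul_of_mapMulLeft ν' hinv (hs k) htm
    -- pull back the two rectangles along `ψ`
    have hpre1 : ψ ⁻¹' (s k ×ˢ t) = {W | ∀ k' ∈ insert k S, W k' ∈ s k'} := by
      ext W
      simp only [hψ, ht, Set.mem_preimage, Set.mem_prod, Set.mem_setOf_eq, Finset.forall_mem_insert]
      refine ⟨fun ⟨h1, h2⟩ => ⟨h1, fun k' hk' => ?_⟩, fun ⟨h1, h2⟩ => ⟨h1, fun k' hk' => ?_⟩⟩
      · have hne : k' ≠ k := fun h => hk (h ▸ hk')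
        have := h2 k' hk'
        rwa [Function.update_of_ne hne] at this
      · have hne : k' ≠ k := fun h => hk (h ▸ hk')
        rw [Function.update_of_ne hne]
        exact h2 k' hk'
    have hpre2 : ψ ⁻¹' (Set.univ ×ˢ t) = {W | ∀ k' ∈ S, W k' ∈ s k'} := by
      ext W
      simp only [hψ, ht, Set.mem_preimage, Set.mem_prod, Set.mem_univ, true_and, Set.mem_setOf_eq]
      refine ⟨fun h2 k' hk' => ?_, fun h2 k' hk' => ?_⟩
      · have hne : k' ≠ k := fun h => hk (h ▸ hk')
        have := h2 k' hk'
        rwa [Function.update_of_ne hne] at this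
      · have hne : k' ≠ k := fun h => hk (h ▸ hk')
        rw [Function.update_of_ne hne]
        exact h2 k' hk'
    rw [hν', Measure.map_apply hψm ((hs k).prod htm), Measure.map_apply hψm (MeasurableSet.univ.prod htm), hpre1, hpre2,
      ih] at hrect
    rw [hrect, Finset.prod_insert hk]
    ring

/-- **COORDINATEWISE LEFT-INVARIANCE ⇒ PRODUCT HAAR**: a probability measure on `κ → G` invariant under `W ↦ W[k ↦ g·W k]` for all `k`, `g` is
`⊗_κ haar`. [folklore] -/
theorem eq_pi_haar_of_forall_map_update_mul (ν : Measure (κ → G)) [IsProbabilityMeasure ν]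
    (hν : ∀ (k : κ) (g : G), ν.map (fun W => Function.update W k (g * W k)) = ν) :
    ν = Measure.pi fun _ : κ => (HaarData.haar : Measure G) := by
  refine (Measure.pi_eq fun s hs => ?_).symm
  have h := measure_box_eq ν hν s hs Finset.univ
  simp only [Finset.mem_univ, forall_true_left, measure_univ, one_mul] at h
  rw [← h]
  congr 1
  ext W
  simp

end Coordinatewise

/-! ## §2 Skew left translations preserve product Haar -/

section Skew

variable {ι : Type*} [Fintype ι]

/-- **A SKEW LEFT TRANSLATION PRESERVES `dU`**: with `q` the FIXED coordinates, the map `U ↦ (i ↦ U i if q i, a(U) i · U i otherwise)` whose factors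
`a(U)` read only the fixed coordinates preserves product Haar. [folklore] -/
theorem measurePreserving_skewMulLeft (q : ι → Prop) [DecidablePred q] (a : (ι → G) → ι → G) (ha : Measurable a)
    (hdep : ∀ U U' : ι → G, (∀ i, q i → U i = U' i) → a U = a U') :
    MeasurePreserving (fun (U : ι → G) (i : ι) => if q i then U i else a U i * U i)
      (Measure.pi fun _ : ι => (HaarData.haar : Measure G)) (Measure.pi fun _ : ι => (HaarData.haar : Measure G)) := by
  set e := MeasurableEquiv.piEquivPiSubtypeProd (fun _ : ι => G) q with he
  have hem : MeasurePreserving e (Measure.pi fun _ : ι => (HaarData.haar : Measure G))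
      ((Measure.pi fun _ : {i // q i} => (HaarData.haar : Measure G)).prod
        (Measure.pi fun _ : {i // ¬ q i} => (HaarData.haar : Measure G))) :=
    measurePreserving_piEquivPiSubtypeProd (fun _ : ι => (HaarData.haar : Measure G)) q
  -- the factors as a function of the fixed coordinates alone (other coordinates set to `1`)
  set ext : ({i // q i} → G) → ι → G := fun x i => if h : q i then x ⟨i, h⟩ else 1 with hext
  have hextm : Measurable ext := by
    refine measurable_pi_lambda _ fun i => ?_
    by_cases h : q i
    · have hm : Measurable fun x : {i // q i} → G => x ⟨i, h⟩ := measurable_pi_apply _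
      simpa [hext, h] using hm
    · simp [hext, h]
  set c : ({i // q i} → G) → ι → G := fun x => a (ext x) with hc
  have hcm : Measurable c := ha.comp hextm
  have hcU : ∀ U : ι → G, c (fun x => U x) = a U := fun U =>
    hdep _ _ fun i hi => by simp [hext, hi]
  set T' : ({i // q i} → G) × ({i // ¬ q i} → G) → ({i // q i} → G) × ({i // ¬ q i} → G) :=
    fun p => (p.1, fun i => c p.1 i * p.2 i) with hT'def
  have hT' : MeasurePreserving T' ((Measure.pi fun _ : {i // q i} => (HaarData.haar : Measure G)).prod
        (Measure.pi fun _ : {i // ¬ q i} => (HaarData.haar : Measure G)))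
      ((Measure.pi fun _ : {i // q i} => (HaarData.haar : Measure G)).prod
        (Measure.pi fun _ : {i // ¬ q i} => (HaarData.haar : Measure G))) := by
    refine MeasurePreserving.skew_product (f := id) (MeasurePreserving.id _)
      (g := fun (x : {i // q i} → G) (y : {i // ¬ q i} → G) => fun i : {i // ¬ q i} => c x i * y i) ?_ (ae_of_all _ fun x => ?_)
    · refine measurable_pi_lambda _ fun i => ?_
      have h1 : Measurable fun p : ({i // q i} → G) × ({i // ¬ q i} → G) => c p.1 i :=
        (measurable_pi_apply (i : ι)).comp (hcm.comp measurable_fst)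
      have h2 : Measurable fun p : ({i // q i} → G) × ({i // ¬ q i} → G) => p.2 i :=
        (measurable_pi_apply i).comp measurable_snd
      exact h1.mul h2
    · exact (measurePreserving_pi (fun _ : {i // ¬ q i} => (HaarData.haar : Measure G)) (fun _ => HaarData.haar)
        (f := fun (i : {i // ¬ q i}) (y : G) => c x i * y) (fun i => ⟨measurable_const_mul _, HaarData.map_mul_left _⟩)).map_eq
  have hfun : (fun (U : ι → G) (i : ι) => if q i then U i else a U i * U i) = e.symm ∘ T' ∘ e := by
    funext U i
    simp only [Function.comp_apply, he, hT'def, MeasurableEquiv.piEquivPiSubtypeProd, MeasurableEquiv.symm_mk,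
      MeasurableEquiv.coe_mk, Equiv.piEquivPiSubtypeProd, Equiv.coe_fn_symm_mk, Equiv.coe_fn_mk]
    by_cases hi : q i
    · simp [hi]
    · simp [hi, hcU U]
  rw [hfun]
  exact hem.symm.comp (hT'.comp hem)

end Skew

/-! ## §3 The engine -/

section Engine

variable {ι κ : Type*} [Fintype ι] [Fintype κ] [DecidableEq κ]

/-- **THE EXACTNESS ENGINE**: let `V : (ι → G) → (κ → G)` be measurable.  Suppose that for every coarse coordinate `k` and every `g ∈ G` there are a
set of FIXED fine coordinates `q k` and factors `a k g U` reading only the fixed coordinates such that the skew left translation by `a k g` (moving the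
other — PRIVATE — coordinates) realises `V ↦ V[k ↦ g · V k]`.  Then `V_*(dU) = ⊗_κ haar`: the coarse variables are EXACTLY independent Haar. [folklore] -/
theorem map_eq_pi_haar_of_private (V : (ι → G) → (κ → G)) (hV : Measurable V)
    (q : κ → ι → Prop) [∀ k, DecidablePred (q k)] (a : κ → G → (ι → G) → ι → G) (ha : ∀ k g, Measurable (a k g))
    (hdep : ∀ k g (U U' : ι → G), (∀ i, q k i → U i = U' i) → a k g U = a k g U')
    (hreal : ∀ k g (U : ι → G), V (fun i => if q k i then U i else a k g U i * U i) = Function.update (V U) k (g * V U k)) :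
    (Measure.pi fun _ : ι => (HaarData.haar : Measure G)).map V = Measure.pi fun _ : κ => (HaarData.haar : Measure G) := by
  haveI : IsProbabilityMeasure ((Measure.pi fun _ : ι => (HaarData.haar : Measure G)).map V) :=
    Measure.isProbabilityMeasure_map hV.aemeasurable
  refine eq_pi_haar_of_forall_map_update_mul _ fun k g => ?_
  rw [Measure.map_map (measurable_update_mul k g) hV]
  have hcomp : (fun W : κ → G => Function.update W k (g * W k)) ∘ V =
      V ∘ fun (U : ι → G) (i : ι) => if q k i then U i else a k g U i * U i := by
    funext U; simp only [Function.comp_apply, hreal]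
  rw [hcomp, ← Measure.map_map hV (measurePreserving_skewMulLeft (q k) (a k g) (ha k g) (hdep k g)).measurable,
    (measurePreserving_skewMulLeft (q k) (a k g) (ha k g) (hdep k g)).map_eq]

end Engine

/-! ## §4 Sanity instance: the (0.4) block averaging with the TRIVIAL small-loop average (= the axial averaging) meets the engine -/

section Axial

open Literature.MathematicalPhysics.QuantumFieldTheory.Balaban1983to89.AveragingRT (axialAvg)
open Literature.MathematicalPhysics.QuantumFieldTheory.Balaban1983to89.BlockAveraging (avgFun avgFun_trivial)
open Literature.MathematicalPhysics.QuantumFieldTheory.Balaban1983to89.BlockAveragingHaarAC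
  (centralBond pre post pre_update axialAvg_eq_pre_mul_mul_post isLocal_avgFun)

variable {P : Params} {j : ℕ}

omit [MeasurableSpace G] [HaarData G] [MeasurableMul₂ G] in
/-- **THE AXIAL AVERAGING HAS THE PRIVATE STRUCTURE**: the skew left translation of the central crossing bond `β(c)` by `(pre U c)⁻¹ · g · pre U c`
(a factor reading only the first half of the line of `c`) left-translates the coarse variable at `c` by `g` and fixes every other coarse variable.
[folklore] -/
theorem axial_private_structure [DecidableEq (PBond P j)] [DecidableEq (PBond P (j+1))] (hj : j + 1 ≤ P.m + P.K) (c : PBond P (j+1)) (g : G) (U : GaugeField P j G) :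
    avgFun (LoopAverage.trivial G)
        (fun i => if i ≠ centralBond c then U i else ((pre U c)⁻¹ * g * pre U c) * U i) =
      Function.update (avgFun (LoopAverage.trivial G) U) c (g * avgFun (LoopAverage.trivial G) U c) := by
  have hupd : (fun i => if i ≠ centralBond c then U i else ((pre U c)⁻¹ * g * pre U c) * U i) =
      Function.update U (centralBond c) (((pre U c)⁻¹ * g * pre U c) * U (centralBond c)) := by
    funext i
    by_cases hi : i = centralBond c
    · subst hi; simp
    · simp [hi]
  rw [hupd]
  funext c'
  by_cases hc' : c' = c
  · subst hc'
    rw [Function.update_self, avgFun_trivial, avgFun_trivial, axialAvg_eq_pre_mul_mul_post, axialAvg_eq_pre_mul_mul_post,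
      pre_update hj, BlockAveragingHaarAC.post_update hj, Function.update_self]
    group
  · rw [Function.update_of_ne hc']
    exact isLocal_avgFun hj (LoopAverage.trivial G) U c _ c' hc'

/-- **E6′ FOR THE (0.4) BLOCK AVERAGING WITH THE TRIVIAL SMALL-LOOP AVERAGE, BY THE ENGINE**: `(avgFun 1)_*(dU) = dV` exactly (the axial case
`AveragingRT.map_axialAvg`, re-derived through §3 as a check of the engine's hypotheses). [folklore] -/
theorem map_avgFun_trivial_eq [MeasurableInv G] [DecidableEq (PBond P j)] [DecidableEq (PBond P (j+1))] (hj : j + 1 ≤ P.m + P.K) :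
    (fieldMeasure P j G).map (avgFun (LoopAverage.trivial G) : GaugeField P j G → GaugeField P (j+1) G) =
      fieldMeasure P (j+1) G := by
  have hmeas : Measurable (avgFun (LoopAverage.trivial G) : GaugeField P j G → GaugeField P (j+1) G) := by
    have : (avgFun (LoopAverage.trivial G) : GaugeField P j G → GaugeField P (j+1) G) = axialAvg := funext avgFun_trivial
    rw [this]; exact AveragingRT.measurable_axialAvg
  have hpre : ∀ c : PBond P (j+1), Measurable fun U : GaugeField P j G => pre U c := fun c =>
    T4Continuum.measurable_holAt _
  refine map_eq_pi_haar_of_private (ι := PBond P j) (κ := PBond P (j+1)) _ hmeas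
    (fun c i => i ≠ centralBond c) (fun c g U _ => (pre U c)⁻¹ * g * pre U c)
    (fun c g => measurable_pi_lambda _ fun _ => ((hpre c).inv.mul_const g).mul (hpre c)) (fun c g U U' hUU' => ?_)
    (fun c g U => axial_private_structure hj c g U)
  -- the factor reads only coordinates off `β(c)`: `U'` is `U` updated at `β(c)`
  have hU' : U' = Function.update U (centralBond c) (U' (centralBond c)) := by
    funext i
    by_cases hi : i = centralBond c
    · subst hi; simp
    · rw [Function.update_of_ne hi]; exact (hUU' i hi).symm
  funext i
  rw [hU', pre_update hj]

end Axial

end Summit.QuantumFields.YangMills.Theorems.HaarExactEngine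

end
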